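import Summits.QuantumFields.YangMills.Theorems.SwapVirialDeficitSectorLaplaceBulkFibredBox
import Summits.QuantumFields.YangMills.Theorems.SwapVirialDeficitSectorLaplaceDefs
import HarnessLib

/-!
# (S)-road, stub S2 BY NAME in fcl-p3 g47's letters (✓`SectorLaplaceDefs`): `SectorLaplace.bulk_fibred`
# (free-hands support of ⟨stmt-QuantumFields-24197⟩ `SwapVirialDeficit.SwapGluedStiffness` ∕ ⟨24194⟩)

✓`BlowUpRing.bulk_fibred_box` (w2 g59, letters unfolded, exponent `(7 + 3|Fol L|)/2`) read through g47's tree definitions `HubBulk`, `GoodSign`, `boxIntegral`, `BaseBox`,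
`mbDensity`, `fibQ`, `alpha` (`= finrank ℝ (GnoFibre L)/2`, ✓`finrank_gnoFibre_eq_card`): the statement of the skeleton stub `stub_bulk_fibred` VERBATIM, so the skeleton's
line is `exact bulk_fibred`.

HONEST LABEL: a renaming; ⟨24197⟩ ∕ ⟨24194⟩ (window-uniform) OPEN; own crux ⟨22884⟩ OPEN (blocked-on ⟨19935⟩); no crux, rung of record or summit is proved; the Yang–Mills
mass gap is NOT proved; no summit is proved by a line.  Width seat ym-line-sfw-p2-w2 g59 (cell ym-idea-1, free hands), `--supports stmt-QuantumFields-24197`.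
THEOREMS ONLY (0 `def`, 0 `sorry`), standard axioms.  References: [cite: Luscher1983, §2]; [cite: HasenpflugRudolfSprungk2024, App. 4.1 Thm 16]; [folklore].
-/

set_option autoImplicit false
set_option synthInstance.maxSize 1024

noncomputable section

open MeasureTheory Quaternion Set Module
open scoped Quaternion BigOperators ENNReal
open Literature.MathematicalPhysics.QuantumLattice
open Literature.MathematicalPhysics.QuantumFieldTheory hiding SU2

namespace Summit.QuantumFields.YangMills.Theorems.SwapVirialDeficit.SectorLaplace

open Summit.QuantumFields.YangMills.Theorems.FemtoTransferGap
open Summit.QuantumFields.YangMills.Theorems.FemtoTransferGap.TT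
open Summit.QuantumFields.YangMills.Theorems.VirialFluxGap.RingDeficit
open Summit.QuantumFields.YangMills.Theorems.SwapVirialDeficit.SwapRing
open Summit.QuantumFields.YangMills.Theorems.SwapVirialDeficit.BlowUpRing

/-- ★★★ **STUB S2 `stub_bulk_fibred` OF THE (S)-SKELETON, BY NAME.**  For every cut `ψ₀ ∈ (0,1]`, box `V₀ ≥ 1`, `b ≥ (K L^k (V₀/ψ₀)^k)²`, bulk hub `a ∈ HubBulk ψ₀` and good
signs: `|boxIntegral a ε b V₀ − (2π/b)^{α}·∫_{BaseBox V₀} 𝔪(a,ε,·)| ≤ K L^k (V₀/ψ₀)^k b^{−1/2}·((2π/b)^{α}·∫_{BaseBox V₀} 𝔪) + (∫ρ)·e^{−b(ψ₀/(K L^k V₀^k))^k}`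
(`K = 26963·82944⁸`, `k = 80`; ✓`BlowUpRing.bulk_fibred_box`). [cite: Luscher1983, §2] [cite: HasenpflugRudolfSprungk2024, App. 4.1 Thm 16] -/
theorem bulk_fibred : ∃ K : ℝ, 0 < K ∧ ∃ k : ℕ, ∀ (L : ℕ) [NeZero L] (ψ₀ V₀ b : ℝ), 0 < ψ₀ → ψ₀ ≤ 1 → 1 ≤ V₀ →
    (K * (L : ℝ) ^ k * (V₀ / ψ₀) ^ k) ^ 2 ≤ b → ∀ a : ℍ, a ∈ HubBulk ψ₀ → ∀ ε : GnoSign L, GoodSign ε →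
      |boxIntegral a ε b V₀ - (2 * Real.pi / b) ^ alpha L * ∫ p in BaseBox V₀, mbDensity a ε p| ≤
        K * (L : ℝ) ^ k * (V₀ / ψ₀) ^ k * b ^ (-(1 / 2 : ℝ)) * ((2 * Real.pi / b) ^ alpha L * ∫ p in BaseBox V₀, mbDensity a ε p) +
          (∫ η : GnoCoord L, gnoDensity η) * Real.exp (-(b * (ψ₀ / (K * (L : ℝ) ^ k * V₀ ^ k)) ^ k)) := by
  obtain ⟨K, hK, k, h⟩ := bulk_fibred_box
  refine ⟨K, hK, k, fun L _ ψ₀ V₀ b hψ₀ hψ₁ hV₀ hb a ha ε hε => ?_⟩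
  obtain ⟨ha0, hS1, hS2⟩ := ha
  have hmain := h L ψ₀ V₀ b hψ₀ hψ₁ hV₀ hb a ha0 hS1 hS2 ε hε.1 hε.2
  simp only [boxIntegral, mbDensity, fibQ, alpha, BaseBox, GnoBox, finrank_gnoFibre_eq_card]
  exact hmain

end Summit.QuantumFields.YangMills.Theorems.SwapVirialDeficit.SectorLaplace

end
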